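import Literature.MathematicalPhysics.QuantumFieldTheory.Balaban1983to89.B8LeafKnitRS
import Literature.MathematicalPhysics.QuantumFieldTheory.Balaban1983to89.B8LeafModelZd3PThm2Gamma

/-!
# `Balaban1983to89.B8LeafKnitZd3PGamma` — [Balaban1985RegularSpaces] THE RE-TYPED B8 LEAF `B8LeafKnitRS.B8LeafRS` (Lemma 1 p. 79 – Theorem 8 p. 101)
# AT THE `Ω₀ = ℤᵈ` SUB-FAMILY OF THE RE-TYPED CARRIER `B8LeafModelZd3P.zdGF3P`, EDITION γ — dag-n05-a's knit `B8LeafKnitZd3.b8LeafRS_zd3_univ` (p434572)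
# on the carrier of record after the D-chain re-target: `l1` by kernel instance, `t2 := thm2Printed_zd3P_univ_γ` (n05-w2 D5), `t4 := thm4Printed_zd3P_map_γ`
# (n05-w2 D4), `p3 :=` Proposition 3 AS PRINTED on the carrier taken as ONE hypothesis `hP3` (dag-n05-d's D3 plugs in by name), modulo the member-wise
# sockets of Theorem 4's frame (Prop.-5 base ∕ step ∕ uniqueness, and the β-shaped (1.59) socket over PRINT's class `towerBondsP`); `p5e p5u p6 p7 t8` named
# hypotheses as before

statement-level skeleton of published theorems with citation tags; proofs where landed; nothing here is a claim about the
Yang–Mills mass gap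

PDF held: `paper:balaban1985-cmp99-regular-spaces-gauge-fixing` (journal page = PDF page + 74); pp. 79–101.

CITATION HEADER (lean-in-tree rule).  Cell `pub-ymgap` (YM Track A, HUMAN RULING D-0062 ∕ D-0149), DAG node N05 = [B8], width seat
`pub-ymgap-dag-n05-w3` (g0), CLAIM-1 = W-SEAT-START-LIST v3–v5 §n05 item 3 (D6): the γ twins of the N05 leaf knits.  WHY: the record slot on the old
carrier is dead as typed (dag-n05-d `B8Prop3ShellModeVacuity`, p585094: `C137` over the law class `towerBonds` has no crossing bond); the carrier of
record is re-typed (n05-w1 `B8LeafModelZd3P.zdGF3P`, (γ) one-end-point letters + `C137` over `towerBondsP`); the D-chain re-targets to it: D4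
`B8Thm4Zd3Gamma.thm4Printed_zd3P_map_γ` (n05-w2, in tree), D5 `B8LeafModelZd3PThm2Gamma.thm2Printed_zd3P_univ_γ` (n05-w2), D3 (dag-n05-d, Proposition 3
on the carrier).  THIS FILE is D6's first twin: the leaf face on the sub-family `{i : ZdIdx d L // i.Ω 0 = univ} ↦ zdGF3P`, four conjuncts DISCHARGED BY
KERNEL INSTANCES modulo sockets + `hP3`, five printed statements as named hypotheses — the shape dag-n05-d's D9 knits consume.

WHAT IS PROVED (kernel, 0 sorry, theorems only): ★★ `b8LeafRS_zd3P_univ_γ` — `B8LeafRS d L C₂ (5dL·(26384(d+1)L·inp.B₀)) inp.B₀′ B₁ B₂ c₁ inp B₀β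
(blockPairNA d Lb 𝔸) famUnivP lan cub toAxial` with `l1 := lemma1Printed_blockPairNA`, `t2 := thm2Printed_zd3P_univ_γ … hP3`, `p3 := hP3` restricted,
`t4 := thm4Printed_zd3P_map_γ` (Theorem 4's constant `B₁′ = 5dL·(26384(d+1)L·inp.B₀)` — the bridge price of edition γ, n05-w2), the boundary-layer law of
D4 discharged (void at `Ω₀ = ℤᵈ`); ★ `b8LeafRS_zd3HP_univ_γ` — the same on the H-twin `zdGF3HP` (Theorem 8's source space as printed; `GFData` faces `rfl`).

HONEST SCOPE (A6, director-ym №189 ∕ №196).  A knit BY NAME; every socket is a HYPOTHESIS: the Prop.-5 sockets `SockP5base`∕`SockP5`∕`SockP5u` (N05's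
Prop.-5 lane; uniqueness γ = n05-w4 `B8SockP5uEProviderGamma`) and the β-shaped (1.59) socket over PRINT's class `towerBondsP L i.Ω (i.Λs m)` ∪ `CrossB □₀`
(= print's (1.59) ∕ [4] Thm 3.3; inhabited at truncation `m = 0` by dag-n06-b's γ-univ witnesses, `m ≥ 1` = N06 content, OPEN; at `U₀ = 1` its data have
NO zero mode at print's family members — this seat's `B8Ineq159FlatTopCubeMemberKernel`, p589375 — whereas over the old class `towerBonds` the socket is
FALSE, dag-n05-c p576185); `hP3` = Proposition 3 AS PRINTED on the carrier (dag-n05-d D3).  Not a discharge of N05 (record re-pin pending: n05-w1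
`CarriersB8SubBP`; five printed statements + sockets remain); count-neutral; no count claim; one finite `𝕋⁴` programme at fixed `ε`, Bałaban as printed; the
YM mass gap (Clay) is NOT proved by any of this — R4 closes the conditional finite-`𝕋⁴` rung `BalabanLadder.UV` only; nothing continuum ∕ ℝ⁴ ∕ OS.
No `sorry`, no `def`, no `instance`, no `notation`.  Unit `pub-ymgap-dag-n05-w3` (g0), 2026-08-28.
-/

noncomputable section

namespace Literature.MathematicalPhysics.QuantumFieldTheory.Balaban1983to89.B8LeafKnitZd3PGamma

open B7Prop1Explicit B7Prop2Explicit B7Prop1Local B7Eq92Concrete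
open B7Prop4GeneralLevels (linCovIter)
open B8Ineq132 (covDerivFwd InAk BondTouches)
open B8Eq119TwistedAxial (Restr129 InAx)
open B8Eq184Proof (cfgExp)
open B8Lemma1NonAbelian (mulCfg blockPairNA lemma1Printed_blockPairNA)
open B8Eq140Level (SideTouches)
open B8Eq146AExpansion (iEta)
open B8Eq155JBound (Jcur wsup)
open B8ScaledSupNorm (bondNorm msup)
open B8Eq138LandauZd (IsLandau138W)
open B8LeafKnit (thm4Printed_precomp prop3Printed_precomp)
open B8LeafKnitRS (B8LeafRS)
open B8LeafModelZd (SockP5base SockP5 SockP5u ZdIdx)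
open B8LeafModelZd3P (zdGF3P zdGF3HP)
open B8TowerBondsPrinted (towerBondsP)
open B9SupplySockB9P3ZdBeta (CrossB)
open B8Thm4Zd3Gamma (thm4Printed_zd3P_map_γ thm4Printed_zd3HP_map_γ)
open B8LeafModelZd3PThm2Gamma (thm2Printed_zd3P_univ_γ thm2Printed_zd3HP_univ_γ)

-- `Site` alone could resolve to the torus sites of `Setup.lean`; re-export the `ℤ^d` sites of `B7Prop1Explicit`.
export B7Prop1Explicit (Site)

variable {d : ℕ}

section Knit

variable {𝔸 : Type} [CStarAlgebra 𝔸] [Nontrivial 𝔸]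
variable {I₃ I₄ : Type} {lan : I₃ → B8.LandauData} {cub : I₄ → B8.CubeData}

/-- ★★ **THE RE-TYPED B8 LEAF AT THE `Ω₀ = ℤᵈ` SUB-FAMILY OF THE RE-TYPED CARRIER `zdGF3P`, EDITION γ — FOUR CONJUNCTS BY KERNEL INSTANCES.**
For `d, L ≥ 2`, the leaf's `inp : B9Inputs` with `2 ≤ 5dL·inp.B₀`, `B₀β > 0`, Prop. 5's radius `cu > 0` and threshold `cP > 0`, a boundary collar `B_∂` with
`0 ≤ B_∂`, `4B_∂ ≤ (dL − 1)·inp.B₀`, a (1.61)-constant `C₂ ≤ 2097152(d+1)²L²`, any Hölder data `β, len`, any block size `Lb`; the member-wise sockets of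
Theorem 4's frame on the re-typed carrier (`SockP5base`, `SockP5`, the β-shaped (1.59) socket over print's class `towerBondsP L i.Ω (i.Λs m)` ∪ `CrossB □₀`,
`SockP5u`); PROPOSITION 3 AS PRINTED on the carrier as one hypothesis `hP3`; and the five remaining printed statements as hypotheses:
`B8LeafRS d L C₂ (5dL·(26384(d+1)L·inp.B₀)) inp.B₀′ B₁ B₂ c₁ inp B₀β (blockPairNA d Lb 𝔸) famUnivP lan cub toAxial` with `l1 := lemma1Printed_blockPairNA`,
`t2 := thm2Printed_zd3P_univ_γ`, `p3 := hP3 ∘ val`, `t4 := thm4Printed_zd3P_map_γ` (boundary-layer law void at `Ω₀ = ℤᵈ`).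
[cite: Balaban1985RegularSpaces, Lemma 1 p.79, Thm 2 p.83, Prop. 3 p.87, Thm 4 p.88 (kernel instances ∕ `hP3`); Prop. 5 p.94, Prop. 6 p.99, Prop. 7 p.100, Thm 8 p.101 (named hypotheses); (1.59) p.86, (1.31) p.82] -/
theorem b8LeafRS_zd3P_univ_γ (hd2 : 2 ≤ d) {L : ℕ} (hL : 2 ≤ L) (Lb : ℕ) (β : ℝ) (len : Site d → ℝ) (inp : B8.B9Inputs)
    {B₀β C₂ cu cP Bbd B₁ B₂ c₁ : ℝ} (hB : 2 ≤ 5 * (d : ℝ) * L * inp.B₀) (hB₀β : 0 < B₀β)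
    (hC₂ : C₂ ≤ 2097152 * ((d : ℝ) + 1) ^ 2 * (L : ℝ) ^ 2) (hcu : 0 < cu) (hcP : 0 < cP) (hBbd : 0 ≤ Bbd)
    (hBd : 4 * Bbd ≤ ((d : ℝ) * L - 1) * inp.B₀)
    (SP5base : ∀ i : ZdIdx d L, SockP5base (𝔸 := 𝔸) L inp.B₀ inp.B₀' cP i.η i.k i.Ω i.Λs)
    (SP5 : ∀ i : ZdIdx d L, SockP5 (𝔸 := 𝔸) L inp.B₀ inp.B₀' cP i.η i.k i.Ω i.Λs)
    (SH59Dβ : ∀ i : ZdIdx d L, ∀ α₀ α₁ : ℝ, 0 < α₀ → 0 < α₁ → α₀ + α₁ ≤ cP →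
        ∀ U₀ U' : Site d → Fin d → 𝔸ˣ, (∀ x κ, U₀ x κ ∈ unitaryUnits 𝔸) → (∀ x κ, U' x κ ∈ unitaryUnits 𝔸) →
        InAk L i.k i.η α₀ i.Ω U₀ → InAk L i.k i.η α₀ i.Ω (mulCfg U' U₀) → (∀ m, m ≤ i.k → InAx L m (i.Λs m) U₀ (mulCfg U' U₀)) →
        (∀ j, j ≤ i.k → ∀ (z : Site d) (μ : Fin d), (∀ x, InBox (loK L j z) (bondHiK L j z μ) x → x ∈ i.Ω j) →
          ‖(avgIter L (mulCfg U' U₀) j z μ : 𝔸) - (avgIter L U₀ j z μ : 𝔸)‖ ≤ α₁) →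
        (∀ b ∈ {b : Site d × Fin d | SideTouches (i.Ω 0) b.1 b.2}, ‖((U' b.1 b.2 : 𝔸ˣ) : 𝔸) - 1‖ ≤ α₁) →
        (∀ m, 1 ≤ m → m ≤ i.k → ∀ (u : Site d → 𝔸ˣ) (W : Site d → Fin d → 𝔸ˣ) (A' : Site d → Fin d → 𝔸),
          (∀ x, u x ∈ unitaryUnits 𝔸) → (∀ x, x ∉ i.Ω 0 → u x = 1) → mgauge U₀ u W = U' → Restr129 L m (i.Λs m) U₀ u →
          IsLandau138W L m i.η (i.Ω 0) (i.Λs m) U₀ W → (∀ y τ, IsSelfAdjoint (A' y τ)) →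
          (∀ j, j ≤ m → ∀ y τ, SideTouches (i.Ω j) y τ →
          W y τ = cfgExp i.η A' y τ ∧ ‖A' y τ‖ ≤ (2 * (L * (5 * (d : ℝ) * L * inp.B₀ * (α₀ + α₁))) + 8 * (8 * inp.B₀' * (5 * (d : ℝ) * L * inp.B₀) * (α₀ + α₁))) * ((L : ℝ) ^ j * i.η)⁻¹) →
          (∀ y τ, (∀ j, j ≤ m → ¬ SideTouches (i.Ω j) y τ) → A' y τ = 0) →
          msup L m i.η (-(1 : ℝ)) (fun j (b : Site d × Fin d) => SideTouches (i.Ω j) b.1 b.2) (fun b => A' b.1 b.2)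
          ≤ inp.B₀ * (bondNorm L m i.η (-(3 : ℝ)) i.Ω (fun x μ => Jcur i.η U₀ A' μ x)
          + wsup 1 (fun p : {p : ℕ × (Site d × Fin d) // p.1 ≤ m ∧ (p.2 ∈ towerBondsP L i.Ω (i.Λs m) p.1 ∨ (p.1 = 0 ∧ CrossB (i.Ω 0) p.2))} =>
          linCovIter L U₀ (iEta i.η A') p.1.1 p.1.2.1 p.1.2.2))
          + Bbd * msup L m i.η (-(1 : ℝ)) (fun j (b : Site d × Fin d) => j = 0 ∧ SideTouches (i.Ω 0) b.1 b.2 ∧ ¬ BondTouches (i.Ω 0) b.1 b.2)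
              (fun b => A' b.1 b.2) ∧
          msup L m i.η (-(2 : ℝ)) (fun j (t : Fin d × Fin d × Site d) => SideTouches (i.Ω j) t.2.2 t.2.1)
          (fun t => covDerivFwd i.η U₀ t.1 (fun z => A' z t.2.1) t.2.2)
          ≤ inp.B₀ * (bondNorm L m i.η (-(3 : ℝ)) i.Ω (fun x μ => Jcur i.η U₀ A' μ x)
          + wsup 1 (fun p : {p : ℕ × (Site d × Fin d) // p.1 ≤ m ∧ (p.2 ∈ towerBondsP L i.Ω (i.Λs m) p.1 ∨ (p.1 = 0 ∧ CrossB (i.Ω 0) p.2))} =>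
          linCovIter L U₀ (iEta i.η A') p.1.1 p.1.2.1 p.1.2.2))
          + Bbd * msup L m i.η (-(1 : ℝ)) (fun j (b : Site d × Fin d) => j = 0 ∧ SideTouches (i.Ω 0) b.1 b.2 ∧ ¬ BondTouches (i.Ω 0) b.1 b.2)
              (fun b => A' b.1 b.2)))
    (SP5u : ∀ i : ZdIdx d L, SockP5u (𝔸 := 𝔸) L cP cu i.η i.k i.Ω i.Λs)
    (hP3 : B8.Prop3Printed d (L : ℝ) C₂ inp B₀β (fun i : ZdIdx d L => (zdGF3P 𝔸 L β len i).toGFData2))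
    {toAxial : ∀ i : {i : ZdIdx d L // i.Ω 0 = Set.univ}, (zdGF3P 𝔸 L β len i.1).Cfg → (zdGF3P 𝔸 L β len i.1).Pert →
      (zdGF3P 𝔸 L β len i.1).Pert}
    (p5e : B8.Prop5Exists inp.B₀' B₁ lan) (p5u : B8.Prop5Unique lan) (p6 : B8.Prop6Printed d (L : ℝ) B₁ c₁ cub)
    (p7 : B8SectGH.Prop7PrintedR (fun i : {i : ZdIdx d L // i.Ω 0 = Set.univ} => zdGF3P 𝔸 L β len i.1) toAxial)
    (t8 : B8Thm8Surviving.Thm8SurvivingAt 1 B₁ B₂ (fun i : {i : ZdIdx d L // i.Ω 0 = Set.univ} => zdGF3P 𝔸 L β len i.1)) :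
    B8LeafRS d (L : ℝ) C₂ (5 * (d : ℝ) * L * (26384 * ((d : ℝ) + 1) * L * inp.B₀)) inp.B₀' B₁ B₂ c₁ inp B₀β (blockPairNA d Lb 𝔸)
      (fun i : {i : ZdIdx d L // i.Ω 0 = Set.univ} => zdGF3P 𝔸 L β len i.1) lan cub toAxial where
  l1 := lemma1Printed_blockPairNA d Lb 𝔸
  t2 := thm2Printed_zd3P_univ_γ hd2 hL inp hB₀β hB hcu hcP hBbd hBd hC₂ SP5base SP5 SH59Dβ SP5u hP3
  p3 := prop3Printed_precomp (fun i : {i : ZdIdx d L // i.Ω 0 = Set.univ} => i.1) d (L : ℝ) C₂ inp B₀β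
    (fun i : ZdIdx d L => (zdGF3P 𝔸 L β len i).toGFData2) hP3
  t4 := thm4Printed_zd3P_map_γ hd2 hL inp.B₀_pos inp.B₀'_pos hB hcu hcP hBbd hBd (fun i : {i : ZdIdx d L // i.Ω 0 = Set.univ} => i.1)
    (fun j _ _ _ _ z _ hz _ => absurd (by rw [j.2]; exact Set.mem_univ z) hz)
    (fun j => SP5base j.1) (fun j => SP5 j.1) (fun j => SH59Dβ j.1) (fun j => SP5u j.1)
  p5e := p5e
  p5u := p5u
  p6 := p6
  p7 := p7
  t8 := t8

/-- ★ **The same leaf face on the H-twin `zdGF3HP`** (Theorem 8's source space as printed; every `GFData`∕`GFData2` face of `zdGF3HP` IS `zdGF3P`'s by `rfl`,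
`B8LeafModelZd3P.zdGF3HP_toGFData`∕`_toGFData2`) — the form NODE 00's re-pinned slot `famB8OfRecordSubBP := zdGF3HP ∘ val` reads; `p7`∕`t8` hypotheses
on the H-twin. [cite: Balaban1985RegularSpaces, Lemma 1 p.79, Thm 2 p.83, Prop. 3 p.87, Thm 4 p.88, Thm 8 (1.146) p.101 (bookkeeping)] -/
theorem b8LeafRS_zd3HP_univ_γ (hd2 : 2 ≤ d) {L : ℕ} (hL : 2 ≤ L) (Lb : ℕ) (β : ℝ) (len : Site d → ℝ) (inp : B8.B9Inputs)
    {B₀β C₂ cu cP Bbd B₁ B₂ c₁ : ℝ} (hB : 2 ≤ 5 * (d : ℝ) * L * inp.B₀) (hB₀β : 0 < B₀β)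
    (hC₂ : C₂ ≤ 2097152 * ((d : ℝ) + 1) ^ 2 * (L : ℝ) ^ 2) (hcu : 0 < cu) (hcP : 0 < cP) (hBbd : 0 ≤ Bbd)
    (hBd : 4 * Bbd ≤ ((d : ℝ) * L - 1) * inp.B₀)
    (SP5base : ∀ i : ZdIdx d L, SockP5base (𝔸 := 𝔸) L inp.B₀ inp.B₀' cP i.η i.k i.Ω i.Λs)
    (SP5 : ∀ i : ZdIdx d L, SockP5 (𝔸 := 𝔸) L inp.B₀ inp.B₀' cP i.η i.k i.Ω i.Λs)
    (SH59Dβ : ∀ i : ZdIdx d L, ∀ α₀ α₁ : ℝ, 0 < α₀ → 0 < α₁ → α₀ + α₁ ≤ cP →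
        ∀ U₀ U' : Site d → Fin d → 𝔸ˣ, (∀ x κ, U₀ x κ ∈ unitaryUnits 𝔸) → (∀ x κ, U' x κ ∈ unitaryUnits 𝔸) →
        InAk L i.k i.η α₀ i.Ω U₀ → InAk L i.k i.η α₀ i.Ω (mulCfg U' U₀) → (∀ m, m ≤ i.k → InAx L m (i.Λs m) U₀ (mulCfg U' U₀)) →
        (∀ j, j ≤ i.k → ∀ (z : Site d) (μ : Fin d), (∀ x, InBox (loK L j z) (bondHiK L j z μ) x → x ∈ i.Ω j) →
          ‖(avgIter L (mulCfg U' U₀) j z μ : 𝔸) - (avgIter L U₀ j z μ : 𝔸)‖ ≤ α₁) →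
        (∀ b ∈ {b : Site d × Fin d | SideTouches (i.Ω 0) b.1 b.2}, ‖((U' b.1 b.2 : 𝔸ˣ) : 𝔸) - 1‖ ≤ α₁) →
        (∀ m, 1 ≤ m → m ≤ i.k → ∀ (u : Site d → 𝔸ˣ) (W : Site d → Fin d → 𝔸ˣ) (A' : Site d → Fin d → 𝔸),
          (∀ x, u x ∈ unitaryUnits 𝔸) → (∀ x, x ∉ i.Ω 0 → u x = 1) → mgauge U₀ u W = U' → Restr129 L m (i.Λs m) U₀ u →
          IsLandau138W L m i.η (i.Ω 0) (i.Λs m) U₀ W → (∀ y τ, IsSelfAdjoint (A' y τ)) →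
          (∀ j, j ≤ m → ∀ y τ, SideTouches (i.Ω j) y τ →
          W y τ = cfgExp i.η A' y τ ∧ ‖A' y τ‖ ≤ (2 * (L * (5 * (d : ℝ) * L * inp.B₀ * (α₀ + α₁))) + 8 * (8 * inp.B₀' * (5 * (d : ℝ) * L * inp.B₀) * (α₀ + α₁))) * ((L : ℝ) ^ j * i.η)⁻¹) →
          (∀ y τ, (∀ j, j ≤ m → ¬ SideTouches (i.Ω j) y τ) → A' y τ = 0) →
          msup L m i.η (-(1 : ℝ)) (fun j (b : Site d × Fin d) => SideTouches (i.Ω j) b.1 b.2) (fun b => A' b.1 b.2)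
          ≤ inp.B₀ * (bondNorm L m i.η (-(3 : ℝ)) i.Ω (fun x μ => Jcur i.η U₀ A' μ x)
          + wsup 1 (fun p : {p : ℕ × (Site d × Fin d) // p.1 ≤ m ∧ (p.2 ∈ towerBondsP L i.Ω (i.Λs m) p.1 ∨ (p.1 = 0 ∧ CrossB (i.Ω 0) p.2))} =>
          linCovIter L U₀ (iEta i.η A') p.1.1 p.1.2.1 p.1.2.2))
          + Bbd * msup L m i.η (-(1 : ℝ)) (fun j (b : Site d × Fin d) => j = 0 ∧ SideTouches (i.Ω 0) b.1 b.2 ∧ ¬ BondTouches (i.Ω 0) b.1 b.2)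
              (fun b => A' b.1 b.2) ∧
          msup L m i.η (-(2 : ℝ)) (fun j (t : Fin d × Fin d × Site d) => SideTouches (i.Ω j) t.2.2 t.2.1)
          (fun t => covDerivFwd i.η U₀ t.1 (fun z => A' z t.2.1) t.2.2)
          ≤ inp.B₀ * (bondNorm L m i.η (-(3 : ℝ)) i.Ω (fun x μ => Jcur i.η U₀ A' μ x)
          + wsup 1 (fun p : {p : ℕ × (Site d × Fin d) // p.1 ≤ m ∧ (p.2 ∈ towerBondsP L i.Ω (i.Λs m) p.1 ∨ (p.1 = 0 ∧ CrossB (i.Ω 0) p.2))} =>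
          linCovIter L U₀ (iEta i.η A') p.1.1 p.1.2.1 p.1.2.2))
          + Bbd * msup L m i.η (-(1 : ℝ)) (fun j (b : Site d × Fin d) => j = 0 ∧ SideTouches (i.Ω 0) b.1 b.2 ∧ ¬ BondTouches (i.Ω 0) b.1 b.2)
              (fun b => A' b.1 b.2)))
    (SP5u : ∀ i : ZdIdx d L, SockP5u (𝔸 := 𝔸) L cP cu i.η i.k i.Ω i.Λs)
    (hP3 : B8.Prop3Printed d (L : ℝ) C₂ inp B₀β (fun i : ZdIdx d L => (zdGF3P 𝔸 L β len i).toGFData2))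
    {toAxial : ∀ i : {i : ZdIdx d L // i.Ω 0 = Set.univ}, (zdGF3HP 𝔸 L β len i.1).Cfg → (zdGF3HP 𝔸 L β len i.1).Pert →
      (zdGF3HP 𝔸 L β len i.1).Pert}
    (p5e : B8.Prop5Exists inp.B₀' B₁ lan) (p5u : B8.Prop5Unique lan) (p6 : B8.Prop6Printed d (L : ℝ) B₁ c₁ cub)
    (p7 : B8SectGH.Prop7PrintedR (fun i : {i : ZdIdx d L // i.Ω 0 = Set.univ} => zdGF3HP 𝔸 L β len i.1) toAxial)
    (t8 : B8Thm8Surviving.Thm8SurvivingAt 1 B₁ B₂ (fun i : {i : ZdIdx d L // i.Ω 0 = Set.univ} => zdGF3HP 𝔸 L β len i.1)) :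
    B8LeafRS d (L : ℝ) C₂ (5 * (d : ℝ) * L * (26384 * ((d : ℝ) + 1) * L * inp.B₀)) inp.B₀' B₁ B₂ c₁ inp B₀β (blockPairNA d Lb 𝔸)
      (fun i : {i : ZdIdx d L // i.Ω 0 = Set.univ} => zdGF3HP 𝔸 L β len i.1) lan cub toAxial where
  l1 := lemma1Printed_blockPairNA d Lb 𝔸
  t2 := thm2Printed_zd3HP_univ_γ hd2 hL inp hB₀β hB hcu hcP hBbd hBd hC₂ SP5base SP5 SH59Dβ SP5u hP3
  p3 := prop3Printed_precomp (fun i : {i : ZdIdx d L // i.Ω 0 = Set.univ} => i.1) d (L : ℝ) C₂ inp B₀β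
    (fun i : ZdIdx d L => (zdGF3P 𝔸 L β len i).toGFData2) hP3
  t4 := thm4Printed_zd3HP_map_γ hd2 hL inp.B₀_pos inp.B₀'_pos hB hcu hcP hBbd hBd (fun i : {i : ZdIdx d L // i.Ω 0 = Set.univ} => i.1)
    (fun j _ _ _ _ z _ hz _ => absurd (by rw [j.2]; exact Set.mem_univ z) hz)
    (fun j => SP5base j.1) (fun j => SP5 j.1) (fun j => SH59Dβ j.1) (fun j => SP5u j.1)
  p5e := p5e
  p5u := p5u
  p6 := p6
  p7 := p7
  t8 := t8

/-! ## §2 (v1.1) The same faces on an INDEX-MAPPED `Ω₀ = ℤᵈ` sub-family `zdGF3P ∘ ι` — the shape the record re-pin and dag-n05-d's D7∕D9 providers read -/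

open B8LeafKnit (thm2Printed_precomp)

/-- ★★ **THE LEAF FACE ON AN INDEX-MAPPED `Ω₀ = ℤᵈ` SUB-FAMILY** (`ι : J → ZdIdx d L` with `(ι j).Ω 0 = ℤᵈ`; e.g. the record's LAWFUL sub-index, which carries
the truncation-tower laws Theorem 8's provider needs, dag-n05-d D7-3): the `b8LeafRS_zd3P_univ_γ` knit with `t2` restricted along `j ↦ ⟨ι j, _⟩`
(`B8LeafKnit.thm2Printed_precomp` of n05-w2's D5), `p3 := hP3 ∘ ι`, `t4 := thm4Printed_zd3P_map_γ … ι`, and the `p7`∕`t8` hypotheses stated on `zdGF3P ∘ ι`, so a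
provider proved at lawful members plugs in with the laws on its own side. [cite: Balaban1985RegularSpaces, Lemma 1 p.79, Thm 2 p.83, Prop. 3 p.87, Thm 4 p.88 (kernel instances ∕ `hP3`); Prop. 5 p.94, Prop. 6 p.99, Prop. 7 p.100, Thm 8 p.101 (named hypotheses)] -/
theorem b8LeafRS_zd3P_map_γ (hd2 : 2 ≤ d) {L : ℕ} (hL : 2 ≤ L) (Lb : ℕ) (β : ℝ) (len : Site d → ℝ) (inp : B8.B9Inputs)
    {B₀β C₂ cu cP Bbd B₁ B₂ c₁ : ℝ} (hB : 2 ≤ 5 * (d : ℝ) * L * inp.B₀) (hB₀β : 0 < B₀β)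
    (hC₂ : C₂ ≤ 2097152 * ((d : ℝ) + 1) ^ 2 * (L : ℝ) ^ 2) (hcu : 0 < cu) (hcP : 0 < cP) (hBbd : 0 ≤ Bbd)
    (hBd : 4 * Bbd ≤ ((d : ℝ) * L - 1) * inp.B₀)
    (SP5base : ∀ i : ZdIdx d L, SockP5base (𝔸 := 𝔸) L inp.B₀ inp.B₀' cP i.η i.k i.Ω i.Λs)
    (SP5 : ∀ i : ZdIdx d L, SockP5 (𝔸 := 𝔸) L inp.B₀ inp.B₀' cP i.η i.k i.Ω i.Λs)
    (SH59Dβ : ∀ i : ZdIdx d L, ∀ α₀ α₁ : ℝ, 0 < α₀ → 0 < α₁ → α₀ + α₁ ≤ cP →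
        ∀ U₀ U' : Site d → Fin d → 𝔸ˣ, (∀ x κ, U₀ x κ ∈ unitaryUnits 𝔸) → (∀ x κ, U' x κ ∈ unitaryUnits 𝔸) →
        InAk L i.k i.η α₀ i.Ω U₀ → InAk L i.k i.η α₀ i.Ω (mulCfg U' U₀) → (∀ m, m ≤ i.k → InAx L m (i.Λs m) U₀ (mulCfg U' U₀)) →
        (∀ j, j ≤ i.k → ∀ (z : Site d) (μ : Fin d), (∀ x, InBox (loK L j z) (bondHiK L j z μ) x → x ∈ i.Ω j) →
          ‖(avgIter L (mulCfg U' U₀) j z μ : 𝔸) - (avgIter L U₀ j z μ : 𝔸)‖ ≤ α₁) →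
        (∀ b ∈ {b : Site d × Fin d | SideTouches (i.Ω 0) b.1 b.2}, ‖((U' b.1 b.2 : 𝔸ˣ) : 𝔸) - 1‖ ≤ α₁) →
        (∀ m, 1 ≤ m → m ≤ i.k → ∀ (u : Site d → 𝔸ˣ) (W : Site d → Fin d → 𝔸ˣ) (A' : Site d → Fin d → 𝔸),
          (∀ x, u x ∈ unitaryUnits 𝔸) → (∀ x, x ∉ i.Ω 0 → u x = 1) → mgauge U₀ u W = U' → Restr129 L m (i.Λs m) U₀ u →
          IsLandau138W L m i.η (i.Ω 0) (i.Λs m) U₀ W → (∀ y τ, IsSelfAdjoint (A' y τ)) →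
          (∀ j, j ≤ m → ∀ y τ, SideTouches (i.Ω j) y τ →
          W y τ = cfgExp i.η A' y τ ∧ ‖A' y τ‖ ≤ (2 * (L * (5 * (d : ℝ) * L * inp.B₀ * (α₀ + α₁))) + 8 * (8 * inp.B₀' * (5 * (d : ℝ) * L * inp.B₀) * (α₀ + α₁))) * ((L : ℝ) ^ j * i.η)⁻¹) →
          (∀ y τ, (∀ j, j ≤ m → ¬ SideTouches (i.Ω j) y τ) → A' y τ = 0) →
          msup L m i.η (-(1 : ℝ)) (fun j (b : Site d × Fin d) => SideTouches (i.Ω j) b.1 b.2) (fun b => A' b.1 b.2)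
          ≤ inp.B₀ * (bondNorm L m i.η (-(3 : ℝ)) i.Ω (fun x μ => Jcur i.η U₀ A' μ x)
          + wsup 1 (fun p : {p : ℕ × (Site d × Fin d) // p.1 ≤ m ∧ (p.2 ∈ towerBondsP L i.Ω (i.Λs m) p.1 ∨ (p.1 = 0 ∧ CrossB (i.Ω 0) p.2))} =>
          linCovIter L U₀ (iEta i.η A') p.1.1 p.1.2.1 p.1.2.2))
          + Bbd * msup L m i.η (-(1 : ℝ)) (fun j (b : Site d × Fin d) => j = 0 ∧ SideTouches (i.Ω 0) b.1 b.2 ∧ ¬ BondTouches (i.Ω 0) b.1 b.2)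
              (fun b => A' b.1 b.2) ∧
          msup L m i.η (-(2 : ℝ)) (fun j (t : Fin d × Fin d × Site d) => SideTouches (i.Ω j) t.2.2 t.2.1)
          (fun t => covDerivFwd i.η U₀ t.1 (fun z => A' z t.2.1) t.2.2)
          ≤ inp.B₀ * (bondNorm L m i.η (-(3 : ℝ)) i.Ω (fun x μ => Jcur i.η U₀ A' μ x)
          + wsup 1 (fun p : {p : ℕ × (Site d × Fin d) // p.1 ≤ m ∧ (p.2 ∈ towerBondsP L i.Ω (i.Λs m) p.1 ∨ (p.1 = 0 ∧ CrossB (i.Ω 0) p.2))} =>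
          linCovIter L U₀ (iEta i.η A') p.1.1 p.1.2.1 p.1.2.2))
          + Bbd * msup L m i.η (-(1 : ℝ)) (fun j (b : Site d × Fin d) => j = 0 ∧ SideTouches (i.Ω 0) b.1 b.2 ∧ ¬ BondTouches (i.Ω 0) b.1 b.2)
              (fun b => A' b.1 b.2)))
    (SP5u : ∀ i : ZdIdx d L, SockP5u (𝔸 := 𝔸) L cP cu i.η i.k i.Ω i.Λs)
    (hP3 : B8.Prop3Printed d (L : ℝ) C₂ inp B₀β (fun i : ZdIdx d L => (zdGF3P 𝔸 L β len i).toGFData2))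
    {J : Type} (ι : J → ZdIdx d L) (hΩ : ∀ j, (ι j).Ω 0 = Set.univ)
    {toAxial : ∀ j : J, (zdGF3P 𝔸 L β len (ι j)).Cfg → (zdGF3P 𝔸 L β len (ι j)).Pert → (zdGF3P 𝔸 L β len (ι j)).Pert}
    (p5e : B8.Prop5Exists inp.B₀' B₁ lan) (p5u : B8.Prop5Unique lan) (p6 : B8.Prop6Printed d (L : ℝ) B₁ c₁ cub)
    (p7 : B8SectGH.Prop7PrintedR (fun j : J => zdGF3P 𝔸 L β len (ι j)) toAxial)
    (t8 : B8Thm8Surviving.Thm8SurvivingAt 1 B₁ B₂ (fun j : J => zdGF3P 𝔸 L β len (ι j))) :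
    B8LeafRS d (L : ℝ) C₂ (5 * (d : ℝ) * L * (26384 * ((d : ℝ) + 1) * L * inp.B₀)) inp.B₀' B₁ B₂ c₁ inp B₀β (blockPairNA d Lb 𝔸)
      (fun j : J => zdGF3P 𝔸 L β len (ι j)) lan cub toAxial where
  l1 := lemma1Printed_blockPairNA d Lb 𝔸
  t2 := thm2Printed_precomp (fun j : J => (⟨ι j, hΩ j⟩ : {i : ZdIdx d L // i.Ω 0 = Set.univ}))
    (fun i : {i : ZdIdx d L // i.Ω 0 = Set.univ} => (zdGF3P 𝔸 L β len i.1).toGFData)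
    (thm2Printed_zd3P_univ_γ hd2 hL inp hB₀β hB hcu hcP hBbd hBd hC₂ SP5base SP5 SH59Dβ SP5u hP3)
  p3 := prop3Printed_precomp ι d (L : ℝ) C₂ inp B₀β (fun i : ZdIdx d L => (zdGF3P 𝔸 L β len i).toGFData2) hP3
  t4 := thm4Printed_zd3P_map_γ hd2 hL inp.B₀_pos inp.B₀'_pos hB hcu hcP hBbd hBd ι
    (fun j _ _ _ _ z _ hz _ => absurd (by rw [hΩ j]; exact Set.mem_univ z) hz)
    (fun j => SP5base (ι j)) (fun j => SP5 (ι j)) (fun j => SH59Dβ (ι j)) (fun j => SP5u (ι j))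
  p5e := p5e
  p5u := p5u
  p6 := p6
  p7 := p7
  t8 := t8

/-- ★ **The index-mapped face on the H-twin `zdGF3HP ∘ ι`** — the form NODE 00's re-pinned slot `famB8OfRecordSubBP := zdGF3HP ∘ val` and dag-n05-d's
Theorem-8 provider read. [cite: Balaban1985RegularSpaces, Lemma 1 p.79, Thm 2 p.83, Prop. 3 p.87, Thm 4 p.88, Thm 8 (1.146) p.101 (bookkeeping)] -/
theorem b8LeafRS_zd3HP_map_γ (hd2 : 2 ≤ d) {L : ℕ} (hL : 2 ≤ L) (Lb : ℕ) (β : ℝ) (len : Site d → ℝ) (inp : B8.B9Inputs)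
    {B₀β C₂ cu cP Bbd B₁ B₂ c₁ : ℝ} (hB : 2 ≤ 5 * (d : ℝ) * L * inp.B₀) (hB₀β : 0 < B₀β)
    (hC₂ : C₂ ≤ 2097152 * ((d : ℝ) + 1) ^ 2 * (L : ℝ) ^ 2) (hcu : 0 < cu) (hcP : 0 < cP) (hBbd : 0 ≤ Bbd)
    (hBd : 4 * Bbd ≤ ((d : ℝ) * L - 1) * inp.B₀)
    (SP5base : ∀ i : ZdIdx d L, SockP5base (𝔸 := 𝔸) L inp.B₀ inp.B₀' cP i.η i.k i.Ω i.Λs)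
    (SP5 : ∀ i : ZdIdx d L, SockP5 (𝔸 := 𝔸) L inp.B₀ inp.B₀' cP i.η i.k i.Ω i.Λs)
    (SH59Dβ : ∀ i : ZdIdx d L, ∀ α₀ α₁ : ℝ, 0 < α₀ → 0 < α₁ → α₀ + α₁ ≤ cP →
        ∀ U₀ U' : Site d → Fin d → 𝔸ˣ, (∀ x κ, U₀ x κ ∈ unitaryUnits 𝔸) → (∀ x κ, U' x κ ∈ unitaryUnits 𝔸) →
        InAk L i.k i.η α₀ i.Ω U₀ → InAk L i.k i.η α₀ i.Ω (mulCfg U' U₀) → (∀ m, m ≤ i.k → InAx L m (i.Λs m) U₀ (mulCfg U' U₀)) →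
        (∀ j, j ≤ i.k → ∀ (z : Site d) (μ : Fin d), (∀ x, InBox (loK L j z) (bondHiK L j z μ) x → x ∈ i.Ω j) →
          ‖(avgIter L (mulCfg U' U₀) j z μ : 𝔸) - (avgIter L U₀ j z μ : 𝔸)‖ ≤ α₁) →
        (∀ b ∈ {b : Site d × Fin d | SideTouches (i.Ω 0) b.1 b.2}, ‖((U' b.1 b.2 : 𝔸ˣ) : 𝔸) - 1‖ ≤ α₁) →
        (∀ m, 1 ≤ m → m ≤ i.k → ∀ (u : Site d → 𝔸ˣ) (W : Site d → Fin d → 𝔸ˣ) (A' : Site d → Fin d → 𝔸),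
          (∀ x, u x ∈ unitaryUnits 𝔸) → (∀ x, x ∉ i.Ω 0 → u x = 1) → mgauge U₀ u W = U' → Restr129 L m (i.Λs m) U₀ u →
          IsLandau138W L m i.η (i.Ω 0) (i.Λs m) U₀ W → (∀ y τ, IsSelfAdjoint (A' y τ)) →
          (∀ j, j ≤ m → ∀ y τ, SideTouches (i.Ω j) y τ →
          W y τ = cfgExp i.η A' y τ ∧ ‖A' y τ‖ ≤ (2 * (L * (5 * (d : ℝ) * L * inp.B₀ * (α₀ + α₁))) + 8 * (8 * inp.B₀' * (5 * (d : ℝ) * L * inp.B₀) * (α₀ + α₁))) * ((L : ℝ) ^ j * i.η)⁻¹) →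
          (∀ y τ, (∀ j, j ≤ m → ¬ SideTouches (i.Ω j) y τ) → A' y τ = 0) →
          msup L m i.η (-(1 : ℝ)) (fun j (b : Site d × Fin d) => SideTouches (i.Ω j) b.1 b.2) (fun b => A' b.1 b.2)
          ≤ inp.B₀ * (bondNorm L m i.η (-(3 : ℝ)) i.Ω (fun x μ => Jcur i.η U₀ A' μ x)
          + wsup 1 (fun p : {p : ℕ × (Site d × Fin d) // p.1 ≤ m ∧ (p.2 ∈ towerBondsP L i.Ω (i.Λs m) p.1 ∨ (p.1 = 0 ∧ CrossB (i.Ω 0) p.2))} =>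
          linCovIter L U₀ (iEta i.η A') p.1.1 p.1.2.1 p.1.2.2))
          + Bbd * msup L m i.η (-(1 : ℝ)) (fun j (b : Site d × Fin d) => j = 0 ∧ SideTouches (i.Ω 0) b.1 b.2 ∧ ¬ BondTouches (i.Ω 0) b.1 b.2)
              (fun b => A' b.1 b.2) ∧
          msup L m i.η (-(2 : ℝ)) (fun j (t : Fin d × Fin d × Site d) => SideTouches (i.Ω j) t.2.2 t.2.1)
          (fun t => covDerivFwd i.η U₀ t.1 (fun z => A' z t.2.1) t.2.2)
          ≤ inp.B₀ * (bondNorm L m i.η (-(3 : ℝ)) i.Ω (fun x μ => Jcur i.η U₀ A' μ x)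
          + wsup 1 (fun p : {p : ℕ × (Site d × Fin d) // p.1 ≤ m ∧ (p.2 ∈ towerBondsP L i.Ω (i.Λs m) p.1 ∨ (p.1 = 0 ∧ CrossB (i.Ω 0) p.2))} =>
          linCovIter L U₀ (iEta i.η A') p.1.1 p.1.2.1 p.1.2.2))
          + Bbd * msup L m i.η (-(1 : ℝ)) (fun j (b : Site d × Fin d) => j = 0 ∧ SideTouches (i.Ω 0) b.1 b.2 ∧ ¬ BondTouches (i.Ω 0) b.1 b.2)
              (fun b => A' b.1 b.2)))
    (SP5u : ∀ i : ZdIdx d L, SockP5u (𝔸 := 𝔸) L cP cu i.η i.k i.Ω i.Λs)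
    (hP3 : B8.Prop3Printed d (L : ℝ) C₂ inp B₀β (fun i : ZdIdx d L => (zdGF3P 𝔸 L β len i).toGFData2))
    {J : Type} (ι : J → ZdIdx d L) (hΩ : ∀ j, (ι j).Ω 0 = Set.univ)
    {toAxial : ∀ j : J, (zdGF3HP 𝔸 L β len (ι j)).Cfg → (zdGF3HP 𝔸 L β len (ι j)).Pert → (zdGF3HP 𝔸 L β len (ι j)).Pert}
    (p5e : B8.Prop5Exists inp.B₀' B₁ lan) (p5u : B8.Prop5Unique lan) (p6 : B8.Prop6Printed d (L : ℝ) B₁ c₁ cub)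
    (p7 : B8SectGH.Prop7PrintedR (fun j : J => zdGF3HP 𝔸 L β len (ι j)) toAxial)
    (t8 : B8Thm8Surviving.Thm8SurvivingAt 1 B₁ B₂ (fun j : J => zdGF3HP 𝔸 L β len (ι j))) :
    B8LeafRS d (L : ℝ) C₂ (5 * (d : ℝ) * L * (26384 * ((d : ℝ) + 1) * L * inp.B₀)) inp.B₀' B₁ B₂ c₁ inp B₀β (blockPairNA d Lb 𝔸)
      (fun j : J => zdGF3HP 𝔸 L β len (ι j)) lan cub toAxial where
  l1 := lemma1Printed_blockPairNA d Lb 𝔸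
  t2 := thm2Printed_precomp (fun j : J => (⟨ι j, hΩ j⟩ : {i : ZdIdx d L // i.Ω 0 = Set.univ}))
    (fun i : {i : ZdIdx d L // i.Ω 0 = Set.univ} => (zdGF3HP 𝔸 L β len i.1).toGFData)
    (thm2Printed_zd3HP_univ_γ hd2 hL inp hB₀β hB hcu hcP hBbd hBd hC₂ SP5base SP5 SH59Dβ SP5u hP3)
  p3 := prop3Printed_precomp ι d (L : ℝ) C₂ inp B₀β (fun i : ZdIdx d L => (zdGF3P 𝔸 L β len i).toGFData2) hP3
  t4 := thm4Printed_zd3HP_map_γ hd2 hL inp.B₀_pos inp.B₀'_pos hB hcu hcP hBbd hBd ι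
    (fun j _ _ _ _ z _ hz _ => absurd (by rw [hΩ j]; exact Set.mem_univ z) hz)
    (fun j => SP5base (ι j)) (fun j => SP5 (ι j)) (fun j => SH59Dβ (ι j)) (fun j => SP5u (ι j))
  p5e := p5e
  p5u := p5u
  p6 := p6
  p7 := p7
  t8 := t8

end Knit

#print axioms b8LeafRS_zd3P_univ_γ
#print axioms b8LeafRS_zd3HP_univ_γ
#print axioms b8LeafRS_zd3P_map_γ
#print axioms b8LeafRS_zd3HP_map_γ

end Literature.MathematicalPhysics.QuantumFieldTheory.Balaban1983to89.B8LeafKnitZd3PGamma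

end
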